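import Summits.ABC.IUTFork.Cor312VolumesRealFrames
import Summits.ABC.IUTFork.Cor312ProvenanceMod
import Summits.ABC.IUTFork.Cor312ProvenanceReal
import HarnessLib

/-!
# [IUTchIII] Cor. 3.12 — the provenance link `IsSettingOf D P` FOR THE ASSEMBLED REAL SETTING over volume frames,
# modulo two named arithmetic properties of its binders (c312 crew, wave 2, board row W2-F′; ADJUDICATION-SPEC §4 (iii))

Record-only companion (seat abc-iut-c312-8, gen 2); TAKES NO SIDE on Cor. 3.12. plan/ADJUDICATION-SPEC.md §1/§4 (iii) names, as
the non-toy setting at which the typed Cor. 3.12 is read, "the assembled real setting `Cor312.Setting.ofComparison …` tied to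
initial Θ-data by `Cor312Prov.IsSettingOf D P`", and asks for "`IsSettingOf D P` instances … — quote which binders of
`Setting.ofComparison` remain free". The assembled setting of record is abc-iut-c312-6's `Cor312Vol.FrameVolumePieces.
settingOfFrameVolumes` = abc-iut-c312-7's `Cor312.Setting.ofFrames n lat sig split qData (V.toRealFrames thetaBox qCentre) hq hadm
hfin` (`Cor312VolumesRealFrames.lean`, `Cor312HullFrameArch.lean`) over abc-iut-c312-5's index `Thm311.Real.thetaIndexOfInitial D`
(`Thm311RealM.lean`), whose local `q`-volumes are in CLOSED FORM `qLocal j v_ℚ = Σ_i w_i·μ̇^log_i(λ_{q,i})` (`qLocal_ofFrames`).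

THIS FILE gives **`isSettingOf_ofFrames`**: `IsSettingOf D (Setting.ofFrames …)` — the index fields by construction
(`isSettingOf_ofInitial`) and the one quantitative field `−|log(q)| = −(1/2l)·log(q)` ([IUTchIV] p. 23) by
`negLogQ_eq_neg_absLogq_of_pieces_mod` (`Cor312ProvenanceMod.lean`) — MODULO exactly two named properties of the setting's
FREE binders `V.w` (weights) and `qCentre` (the `q`-pilot centre), each a printed clause:
* (hmarg) the weights are [IUTchIII] Rmk. 3.1.1 (ii)'s normalized weights: over every `w ∈ 𝕍^bad_mod` the pieces of the packet at
  `(j, v_ℚ)` lying over `w` (`π`) have `Σ_{i over w} w_i = Pr(w)/[F_mod:ℚ]` for some nonzero `Pr` — for the printed one-packet weight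
  `w_v̲ = 1/([K_v̲:(F_mod)_w]·[F_mod:ℚ])` (p. 94, `Σ_{w|v_ℚ}[(F_mod)_w:ℚ_{v_ℚ}] = [F_mod:ℚ]`) take `Pr(w) := 1/[K_v̲:(F_mod)_w]`; for the
  tensor packet abc-iut-c312-6's `Cor312WeightSums` collapses the weights to a per-place sum of this shape; any nonzero `Pr` works
  since it cancels against (hbad); the NORMALIZED scale, finding N-C8-1;
* (hbad)/(hgood) the centre is the `2l`-th root of the `q`-parameter at the bad places and a unit elsewhere ([IUTchI] Ex. 3.2 (iv)
  `q̲_v̲`, [IUTchIII] Def. 3.8 (i); abc-iut-L6-t24 R7-C5-F1b): `μ̇^log_i(λ_{q,i}) = −h_w·log N(w)/(2l·Pr(w))` over bad `w`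
  (`h_w = −ord_w(j_E)`; with `Pr(w) = 1/[K_v̲:(F_mod)_w]` this is `−[K_v̲:(F_mod)_w]·h_w·log N(w)/(2l) = −ord_{K_v̲}(q̲_v̲)·log q_{K_v̲}`,
  the log-modulus of `q̲_v̲` — `ord_v̲(q̲) = e_{v̲|w}·h_w/(2l)`, `log q_{K_v̲} = f_{v̲|w}·log N(w)`), `= 0` over good `w`.
The remaining free binders of `Setting.ofFrames` (`lat`, `sig`, `split`, `qData`, `thetaBox`, `hq`, `hadm`, `hfin`; C312-RESIDUALS
§1a′) are untouched: `IsSettingOf` does not read them. So the witness of record for §4 (iii) is: index fields `rfl`, `q`-field ⟸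
(hmarg) ∧ (hbad) ∧ (hgood) on `(w, qCentre)`. [claim: Mochizuki2012, status: disputed] for every quotation.

SHAPE NOTE (audit abc-iut-w5-d158, F-w5d158-1, 2026-08-26, CONCURRED by the author; docstring-only revision, declarations
unchanged): `isSettingOf_ofFrames` instantiates the abstract criterion `negLogQ_eq_neg_absLogq_of_pieces_mod` (binders
"weight × degree" `wd` and "centre log-NORM" `n`) with `wd := V.w` and `n := μ̇^log_i` (a log-VOLUME), i.e. with the degree
factor `d_i ≡ 1`; its (hbad) therefore prescribes ONE log-volume per bad place `w` for every field factor over `w`. At the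
genuine Haar factor volume ([AbsTopIII] Prop. 5.7 (i), `FactorVolume.ofUltrametric`: `μ̇^log = −ord·log q_K`) the log-volume of
the `2l`-th root `q̲` in a factor `K_i` is `−[K_i:(F_mod)_w]·h_w·log N(w)/(2l)`, DEGREE-dependent — so (hbad) as stated is
jointly satisfiable with Haar volumes only when all factors over a bad `w` have the same degree (one field factor per place: the
`𝕍 ≅ 𝕍_mod`-indexed ONE-fold packet of the gloss above); for the `(j+1)`-fold tensor packets (`j ≥ 1`, factors = composita of
different degrees over the same `w`) use the DEGREE-WEIGHTED form `Cor312Prov.isSettingOf_ofFrames_of_degrees`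
(`Cor312ProvenanceFramesDegree.lean`, abc-iut-w5-d158: extra binder `d`, (hmargD) `Σ_{i over w} w_i·d_i = Pr(w)/[F_mod:ℚ]`,
(hbadD) `μ̇^log_i(λ_{q,i}) = d_i·(−h_w·log N(w)/(2l·Pr(w)))` — the same criterion with `wd := w·d`; `d_i := [K_i:(F_mod)_w]`,
`Pr ≡ 1` is the Haar-satisfiable instance, its marginal identity being what abc-iut-c312-6's `Cor312WeightSums` supplies for
the printed weights). The present theorems are its `d ≡ 1` case and remain correct as stated.
-/

noncomputable section

namespace Summit.ABC.IUTFork.Cor312Prov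

open Literature.IUT.HodgeTheaters Literature.IUT.LogVolume Literature.IUT.LogThetaLattice NumberField IsDedekindDomain
open Thm311 Cor312 Cor312Vol
open scoped Classical

variable {F K Fbar : Type} [Field F] [NumberField F] [Field K] [NumberField K]
  [Algebra F K] [Field Fbar] [Algebra F Fbar] [Algebra K Fbar] {E : WeierstrassCurve F} [E.IsElliptic]
  {l : ℕ} {Pb : BadPlacePredicates K}

/-- **`IsSettingOf D P` for the assembled real setting over volume frames**, modulo (hmarg)/(hbad)/(hgood) on its free binders
`(w, qCentre)` (module docstring). For an initial Θ-datum `D`, a Thm. 3.11 situation `S` over c312-5's index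
`Thm311.Real.thetaIndexOfInitial D`, volume frames `V` realizing its multiradial representation (`hV`), and the data of
c312-7's `Setting.ofFrames`: if the pieces of each packet lie over places `π` of `F_mod` in the right fibre (`hπ`), the weights
have Rmk. 3.1.1 (ii)'s marginals (`hmarg`) and the `q`-centre's factorwise log-moduli are those of the `2l`-th root of the
`q`-parameter (`hbad`, `hgood`), then the setting IS the situation of `D`: `IsSettingOf D (Setting.ofFrames …)`. PROVED
(`qLocal_ofFrames` + `negLogQ_eq_neg_absLogq_of_pieces_mod` + `isSettingOf_ofInitial`). [claim: Mochizuki2012, status: disputed] -/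
theorem isSettingOf_ofFrames (D : InitialThetaData F K Fbar E l Pb) {S : Situation (Thm311.Real.thetaIndexOfInitial D)}
    {V : FrameVolumePieces S.L} {n : ℤ}
    {HT : Type} {LogLink : HT → HT → Type} {IsFull : ∀ {s t : HT}, LogLink s t → Prop}
    (lat : LGPGaussianLogThetaLattice LogLink IsFull)
    {Frd : Type} {IsoF : Frd → Frd → Type} {Ob : Frd → Type} {realify : Frd → Frd} {Strip : Type}
    {IsoS : Strip → Strip → Type} {M : ∀ v : (Thm311.Real.thetaIndexOfInitial D).V,
      v ∈ (Thm311.Real.thetaIndexOfInitial D).Vbad → Type} [∀ v h, Monoid (M v h)]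
    (sig : GlobalLGPFrobenioidSignature (Thm311.Real.thetaIndexOfInitial D).lstar (Thm311.Real.thetaIndexOfInitial D).V
      (· ∈ (Thm311.Real.thetaIndexOfInitial D).Vbad) Frd IsoF Ob realify Strip IsoS M)
    (split : SplittingMonoids M) {ObΔ : Type} {N : ∀ v : (Thm311.Real.thetaIndexOfInitial D).V,
      v ∈ (Thm311.Real.thetaIndexOfInitial D).Vbad → Type} [∀ v h, Monoid (N v h)]
    (qData : QPilotData ObΔ N)
    (thetaBox : ℤ → Ob sig.Clgp → ∀ j vQ, Set (∀ i, V.K j vQ i))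
    (qCentre : ObΔ → ∀ j vQ, ∀ i, V.K j vQ i)
    (hq : ∀ j vQ i, qCentre (qPilotObject qData) j vQ i ≠ 0)
    (hadm : ∀ j vQ (H : Set (∀ i, V.K j vQ i)), IsHullSet (V.K j vQ) H → (S.D n).Adm j vQ (V.e j vQ ⁻¹' H))
    (hfin : ∀ j : (Thm311.Real.thetaIndexOfInitial D).Label, (Function.support fun vQ => (S.D n).logvol j vQ
      (V.e j vQ ⁻¹' hullSet (V.K j vQ) (qCentre (qPilotObject qData) j vQ))).Finite)
    (hV : V.Realizes (S.D n))
    -- the provenance data of the pieces: `j_E ∈ F_mod`, the prime below, the places of `F_mod` under the pieces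
    (jm : fieldOfModuli E) (hjm : (jm : F) = E.j)
    (gm : FinitePlace (fieldOfModuli E) → (Thm311.Real.thetaIndexOfInitial D).VQ)
    (Pr : FinitePlace (fieldOfModuli E) → ℝ) (hPr : ∀ w ∈ D.VbadMod, Pr w ≠ 0)
    (π : ∀ (j : (Thm311.Real.thetaIndexOfInitial D).Label) (vQ : (Thm311.Real.thetaIndexOfInitial D).VQ),
      V.J j vQ → FinitePlace (fieldOfModuli E))
    (hπ : ∀ j vQ i, gm (π j vQ i) = vQ)
    (hmarg : ∀ j vQ, ∀ w ∈ D.VbadMod, gm w = vQ →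
      ∑ i ∈ Finset.univ.filter (fun i => π j vQ i = w), V.w j vQ i = Pr w / Module.finrank ℚ (fieldOfModuli E))
    (hbad : ∀ j vQ i, π j vQ i ∈ D.VbadMod →
      (V.vol j vQ i).mulLogvol (qCentre (qPilotObject qData) j vQ i) =
        -(-(ord (fieldOfModuli E) (π j vQ i).maximalIdeal jm : ℝ) * logNorm (fieldOfModuli E) (π j vQ i).maximalIdeal) /
          (2 * (l : ℝ) * Pr (π j vQ i)))
    (hgood : ∀ j vQ i, π j vQ i ∉ D.VbadMod → (V.vol j vQ i).mulLogvol (qCentre (qPilotObject qData) j vQ i) = 0) :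
    IsSettingOf D (Setting.ofFrames n lat sig split qData (V.toRealFrames thetaBox qCentre) hq hadm hfin) := by
  refine isSettingOf_ofInitial D _ ?_
  refine negLogQ_eq_neg_absLogq_of_pieces_mod D jm hjm _ gm Pr hPr
    (fun i vQ => V.J (Setting.labelSucc i) vQ) (fun i vQ => π (Setting.labelSucc i) vQ)
    (fun i vQ x => hπ _ vQ x) (fun i vQ => V.w (Setting.labelSucc i) vQ)
    (fun i vQ x => (V.vol (Setting.labelSucc i) vQ x).mulLogvol (qCentre (qPilotObject qData) (Setting.labelSucc i) vQ x))
    (fun i vQ => hmarg _ vQ) (fun i vQ x => hbad _ vQ x) (fun i vQ x => hgood _ vQ x) ?_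
  intro i vQ
  exact FrameVolumePieces.qLocal_ofFrames lat sig split qData thetaBox qCentre hq hadm hfin hV (Setting.labelSucc i) vQ

/-- The same for c312-6's packaged `settingOfFrameVolumes` (= `Setting.ofFrames` with `hadm := hadm_of_realizes hV`). PROVED.
[claim: Mochizuki2012, status: disputed] -/
theorem isSettingOf_settingOfFrameVolumes (D : InitialThetaData F K Fbar E l Pb)
    {S : Situation (Thm311.Real.thetaIndexOfInitial D)} {V : FrameVolumePieces S.L} {n : ℤ}
    {HT : Type} {LogLink : HT → HT → Type} {IsFull : ∀ {s t : HT}, LogLink s t → Prop}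
    (lat : LGPGaussianLogThetaLattice LogLink IsFull)
    {Frd : Type} {IsoF : Frd → Frd → Type} {Ob : Frd → Type} {realify : Frd → Frd} {Strip : Type}
    {IsoS : Strip → Strip → Type} {M : ∀ v : (Thm311.Real.thetaIndexOfInitial D).V,
      v ∈ (Thm311.Real.thetaIndexOfInitial D).Vbad → Type} [∀ v h, Monoid (M v h)]
    (sig : GlobalLGPFrobenioidSignature (Thm311.Real.thetaIndexOfInitial D).lstar (Thm311.Real.thetaIndexOfInitial D).V
      (· ∈ (Thm311.Real.thetaIndexOfInitial D).Vbad) Frd IsoF Ob realify Strip IsoS M)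
    (split : SplittingMonoids M) {ObΔ : Type} {N : ∀ v : (Thm311.Real.thetaIndexOfInitial D).V,
      v ∈ (Thm311.Real.thetaIndexOfInitial D).Vbad → Type} [∀ v h, Monoid (N v h)]
    (qData : QPilotData ObΔ N)
    (thetaBox : ℤ → Ob sig.Clgp → ∀ j vQ, Set (∀ i, V.K j vQ i))
    (qCentre : ObΔ → ∀ j vQ, ∀ i, V.K j vQ i)
    (hq : ∀ j vQ i, qCentre (qPilotObject qData) j vQ i ≠ 0)
    (hfin : ∀ j : (Thm311.Real.thetaIndexOfInitial D).Label, (Function.support fun vQ => (S.D n).logvol j vQ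
      (V.e j vQ ⁻¹' hullSet (V.K j vQ) (qCentre (qPilotObject qData) j vQ))).Finite)
    (hV : V.Realizes (S.D n))
    (jm : fieldOfModuli E) (hjm : (jm : F) = E.j)
    (gm : FinitePlace (fieldOfModuli E) → (Thm311.Real.thetaIndexOfInitial D).VQ)
    (Pr : FinitePlace (fieldOfModuli E) → ℝ) (hPr : ∀ w ∈ D.VbadMod, Pr w ≠ 0)
    (π : ∀ (j : (Thm311.Real.thetaIndexOfInitial D).Label) (vQ : (Thm311.Real.thetaIndexOfInitial D).VQ),
      V.J j vQ → FinitePlace (fieldOfModuli E))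
    (hπ : ∀ j vQ i, gm (π j vQ i) = vQ)
    (hmarg : ∀ j vQ, ∀ w ∈ D.VbadMod, gm w = vQ →
      ∑ i ∈ Finset.univ.filter (fun i => π j vQ i = w), V.w j vQ i = Pr w / Module.finrank ℚ (fieldOfModuli E))
    (hbad : ∀ j vQ i, π j vQ i ∈ D.VbadMod →
      (V.vol j vQ i).mulLogvol (qCentre (qPilotObject qData) j vQ i) =
        -(-(ord (fieldOfModuli E) (π j vQ i).maximalIdeal jm : ℝ) * logNorm (fieldOfModuli E) (π j vQ i).maximalIdeal) /
          (2 * (l : ℝ) * Pr (π j vQ i)))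
    (hgood : ∀ j vQ i, π j vQ i ∉ D.VbadMod → (V.vol j vQ i).mulLogvol (qCentre (qPilotObject qData) j vQ i) = 0) :
    IsSettingOf D (FrameVolumePieces.settingOfFrameVolumes lat sig split qData thetaBox qCentre hq hfin hV) :=
  isSettingOf_ofFrames D lat sig split qData thetaBox qCentre hq _ hfin hV jm hjm gm Pr hPr π hπ hmarg hbad hgood

end Summit.ABC.IUTFork.Cor312Prov

end
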